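import Summits.QuantumFields.YangMills.Theorems.ChatterjeeMassGapTorusAxialBoxConv
import HarnessLib

/-!
# Crux `NT` (stmt-QuantumFields-19353), strong-coupling rungs: EVERY odd convolution power of a non-zero centred class
# function is positive at the identity — `φ^{⋆(2a+2)}(1) = ‖φ^{⋆(a+1)}‖² > 0` for all `a`

Helper file of the fleet lead prover of crux `NT` (unit `ym-spine-19353-p1`, g27).  The Haar constant of the temporal
tube of length `n` (`4n + 2` faces: two caps, `4n` temporal sides) is the `(4n+2)`-nd convolution power of the centred
plaquette function `φ = Re tr ρ − m₀` at the identity; the tree has the positivity for the ten-face box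
(`S28BoxConv.conv_power_nine_at_one_pos`, length `2`) and for the eighteen-face tube
(`LongTube.conv_power_seventeen_at_one_pos`, length `4`), each by an explicit climb-and-descend chain.  Here the
length-generic statement, by the same mechanism organised as two inductions:

* `conv_power_ne_zero_of_add` — non-vanishing descends: `P (a + j) ≢ 0 ⇒ P a ≢ 0` (`conv_power_ne_of_succ` iterated);
* `conv_power_pow_two_sub_one_ne_zero` — non-vanishing climbs along `2^m − 1`: `P (2^m − 1) ≢ 0`
  (`P (2a+1)(1) = ‖P a‖² > 0`, `conv_power_double_pos`);
* `conv_power_ne_zero` — hence EVERY convolution power `P a = φ^{⋆(a+1)}` of a non-zero inversion-invariant continuous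
  class function is non-zero (`a ≤ 2^a − 1`);
* **`conv_power_odd_at_one_pos`** — `0 < P (a + a + 1) (1)` for every `a`.

HONEST FRAMING: Haar-measure algebra on an arbitrary compact group; nothing about `β`, NT or the gap. [folklore]
-/

noncomputable section

open MeasureTheory Filter Topology
open Literature.MathematicalPhysics.QuantumLattice
open Literature.MathematicalPhysics.QuantumFieldTheory (zdHaar haarProbability)

namespace Summit.QuantumFields.YangMills.Cruxes.NT.StrongCouplingRung.LongTube

open Summit.QuantumFields.YangMills.Theorems.S28BoxConv

variable {G : Type} [Group G] [TopologicalSpace G] [IsTopologicalGroup G]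
  [CompactSpace G] [MeasurableSpace G] [BorelSpace G]

/-- Non-vanishing of convolution powers DESCENDS: if `P (a + j) ≢ 0` then `P a ≢ 0`. [folklore] -/
theorem conv_power_ne_zero_of_add {φ : G → ℝ} {P : ℕ → G → ℝ}
    (hstep : ∀ k : ℕ, P (k + 1) = haarConv (P k) φ) (a j : ℕ) (h : ∃ g, P (a + j) g ≠ 0) :
    ∃ g, P a g ≠ 0 := by
  induction j with
  | zero => simpa using h
  | succ j ih =>
    refine ih (conv_power_ne_of_succ hstep (k := a + j) ?_)
    rwa [show a + (j + 1) = a + j + 1 by ring] at h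

/-- Non-vanishing of convolution powers CLIMBS along `2^m − 1`: `P (2^m − 1) ≢ 0` for a non-zero inversion-invariant
continuous class function `φ = P 0` (`P (2a+1)(1) = ‖P a‖² > 0`). [folklore] -/
theorem conv_power_pow_two_sub_one_ne_zero [T2Space G] {φ : G → ℝ} {P : ℕ → G → ℝ} (hφ : Continuous φ)
    (hcl : ∀ s t : G, φ (s * t) = φ (t * s)) (hinv : ∀ h : G, φ h⁻¹ = φ h) (hP0 : P 0 = φ)
    (hstep : ∀ k : ℕ, P (k + 1) = haarConv (P k) φ) (h0 : ∃ g, φ g ≠ 0) (m : ℕ) :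
    ∃ g, P (2 ^ m - 1) g ≠ 0 := by
  induction m with
  | zero => rw [pow_zero, Nat.sub_self, hP0]; exact h0
  | succ m ih =>
    have hpos := conv_power_double_pos hφ hcl hinv hP0 hstep (a := 2 ^ m - 1) ih
    have e : 2 ^ m - 1 + (2 ^ m - 1) + 1 = 2 ^ (m + 1) - 1 := by
      have : 1 ≤ 2 ^ m := Nat.one_le_two_pow
      rw [pow_succ]
      omega
    rw [e] at hpos
    exact ⟨1, hpos.ne'⟩

/-- **Every convolution power of a non-zero inversion-invariant continuous class function is non-zero.** [folklore] -/
theorem conv_power_ne_zero [T2Space G] {φ : G → ℝ} {P : ℕ → G → ℝ} (hφ : Continuous φ)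
    (hcl : ∀ s t : G, φ (s * t) = φ (t * s)) (hinv : ∀ h : G, φ h⁻¹ = φ h) (hP0 : P 0 = φ)
    (hstep : ∀ k : ℕ, P (k + 1) = haarConv (P k) φ) (h0 : ∃ g, φ g ≠ 0) (a : ℕ) :
    ∃ g, P a g ≠ 0 := by
  have hle : a ≤ 2 ^ a - 1 := by
    have := Nat.lt_two_pow_self (n := a)
    omega
  refine conv_power_ne_zero_of_add hstep a (2 ^ a - 1 - a) ?_
  rw [Nat.add_sub_cancel' hle]
  exact conv_power_pow_two_sub_one_ne_zero hφ hcl hinv hP0 hstep h0 a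

/-- **`φ ≢ 0 ⇒ φ^{⋆(2a+2)}(1) = ‖φ^{⋆(a+1)}‖² > 0` for EVERY `a`**: the odd-indexed convolution powers `P (2a+1)` of a
non-zero inversion-invariant continuous class function on a compact group are positive at the identity (the Haar
constant of the temporal tube with `2a + 2` faces, e.g. `a = 4`: ten-face box, `a = 8`: eighteen-face tube,
`a = 2n`: the tube of length `n`). [folklore] -/
theorem conv_power_odd_at_one_pos [T2Space G] {φ : G → ℝ} {P : ℕ → G → ℝ} (hφ : Continuous φ)
    (hcl : ∀ s t : G, φ (s * t) = φ (t * s)) (hinv : ∀ h : G, φ h⁻¹ = φ h) (hP0 : P 0 = φ)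
    (hstep : ∀ k : ℕ, P (k + 1) = haarConv (P k) φ) (h0 : ∃ g, φ g ≠ 0) (a : ℕ) :
    0 < P (a + a + 1) 1 :=
  conv_power_double_pos hφ hcl hinv hP0 hstep (conv_power_ne_zero hφ hcl hinv hP0 hstep h0 a)

end Summit.QuantumFields.YangMills.Cruxes.NT.StrongCouplingRung.LongTube

end
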